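import Literature.AnabelianGeometry.EtaleTheta.Discharge.Sec1ThetaCompanionOfAut
import HarnessLib

/-!
# [EtTh] Prop. 2.2 (i) / [IUTchII] Prop 2.2 (ii): the facet «`ι̂` acts as `−1` on `Δ_X^ab`» is decided on `Δ^tp_X`

S. Mochizuki, *The étale theta function and its Frobenioid-theoretic manifestations*, Publ. RIMS **45** (2009) [EtTh], §1
p. 12 (PRIMS p. 238) «`Δ_X` … the profinite completion of `Δ^tp_X`», §2 p. 36 (PRIMS p. 262) «`ι` … “multiplication by
`−1`”», Prop. 2.2 (i) p. 37; S. Mochizuki, *Topics surrounding the combinatorial anabelian geometry of hyperbolic curves /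
Semi-graphs of anabelioids* [SemiAnbd] §6 p. 69 «natural injection `Π^tp ↪ Π`» (dense image).
[cite: MochizukiEtTh2009, Prop 2.2 (i) p.37]

PROOF-ONLY (no definitions, no `Prop` facts). Cell abc-iut, seat abc-iut-w5-d072 (gen 3; (R1) ι-datum custody, GAP row
G-w4d010-2 / D-G-w4d010-2h). The binder (R1e′) `hinv : ∀ g ∈ Δ_X, ι̂ g · g ∈ closure ⁅Δ_X, Δ_X⁆` of the [IUTchII]
Prop. 2.2 (ii) / Cor. 1.12 (ii) model closers (`prop22_ii'_model_of_inversion_of_hinv` p420219, abc-iut-w4-d043's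
`EtaleLevels.cor112_ii_model`) speaks about the PROFINITE completion `Π_X` and the extended automorphism
`ι̂ = TemperedCurve.completionAut ι`. This file proves, for EVERY `X : TemperedCurve p` and EVERY topological automorphism
`α` of `Π^temp_X`, that it is EQUIVALENT to a statement on the tempered group alone:

  `TemperedCurve.completionAut_mul_self_mem_iff` :
    `(∀ g ∈ Δ_X, α̂ g · g ∈ closure ⁅Δ_X, Δ_X⁆) ↔ (∀ x ∈ Δ^temp_X, ι_X (α x · x) ∈ closure ⁅Δ_X, Δ_X⁆)`,

and the convenient sufficient form `completionAut_mul_self_mem_of_deltaTemp` : if `α x · x ∈ ⁅Δ^temp_X, Δ^temp_X⁆` for all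
`x ∈ Δ^temp_X` («`α` acts as `−1` on `(Δ^temp_X)^ab`») then (R1e′) holds. Route (no cohomology, no universal property):
`Δ_X := closure ι_X(Δ^temp_X)` (root definition `TemperedCurve.DeltaHat`), the set `{g | α̂ g · g ∈ C}` is CLOSED in `Π_X`
(continuity of `α̂` and of multiplication; `C` closed) and `α̂ ∘ ι_X = ι_X ∘ α` (`completionAut_toHat`). This is the generic
form of the argument used at the discrete root model in `SettingModelInversion.lean` (p424489, `inversion_hinv`); it applies
verbatim to any finer model of the §1 root (e.g. the `χ`-twisted model under construction by abc-iut-L6-d6, abc-iut-L2-lead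
R78/R91), where `Δ^temp_X` is no longer discrete. Honest framing: (R1e′) stays a HYPOTHESIS about the datum `ι` at the
interface level; nothing here bears on [IUTchIII] Cor. 3.12; typed ≠ proved.
-/

noncomputable section

namespace Literature.AnabelianGeometry.SemiGraphs

namespace TemperedCurve

open _root_.Topology

variable {p : ℕ} [Fact p.Prime] (X : TemperedCurve p) (α : X.PiTemp ≃ₜ* X.PiTemp)

/-- The set of `g ∈ Π_X` with `α̂ g · g` in a CLOSED subgroup `C` is closed. [cite: MochizukiSemiAnbd2006, §6 p.69] -/
theorem isClosed_setOf_completionAut_mul_self_mem (C : Subgroup X.PiHat) (hC : IsClosed (C : Set X.PiHat)) :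
    IsClosed {g : X.PiHat | X.completionAut α g * g ∈ C} :=
  hC.preimage ((X.completionAut α).continuous.mul continuous_id)

/-- **Density transfer**: if `ι_X(α x · x) ∈ C` for every `x ∈ Δ^temp_X` and `C ≤ Π_X` is closed, then `α̂ g · g ∈ C` for every
`g ∈ Δ_X = closure ι_X(Δ^temp_X)`. [cite: MochizukiSemiAnbd2006, §6 p.69] -/
theorem completionAut_mul_self_mem_of_toHat (C : Subgroup X.PiHat) (hC : IsClosed (C : Set X.PiHat))
    (h : ∀ x ∈ X.DeltaTemp, X.toHat (α x * x) ∈ C) :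
    ∀ g ∈ X.DeltaHat, X.completionAut α g * g ∈ C := by
  have hsub : ((X.DeltaTemp.map X.toHat.toMonoidHom : Subgroup X.PiHat) : Set X.PiHat) ⊆
      {g : X.PiHat | X.completionAut α g * g ∈ C} := by
    rintro _ ⟨x, hx, rfl⟩
    change X.completionAut α (X.toHat x) * X.toHat x ∈ C
    rw [completionAut_toHat, ← map_mul]
    exact h x hx
  intro g hg
  have hg' : g ∈ closure ((X.DeltaTemp.map X.toHat.toMonoidHom : Subgroup X.PiHat) : Set X.PiHat) := by
    rw [← Subgroup.topologicalClosure_coe]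
    exact hg
  exact closure_minimal hsub (X.isClosed_setOf_completionAut_mul_self_mem α C hC) hg'

/-- **(R1e′) is decided on the tempered group.** For every topological automorphism `α` of `Π^temp_X`:
«`α̂` acts as `−1` on `Δ_X^ab`» (`∀ g ∈ Δ_X, α̂ g · g ∈ closure ⁅Δ_X, Δ_X⁆`) iff `ι_X(α x · x) ∈ closure ⁅Δ_X, Δ_X⁆` for every
`x ∈ Δ^temp_X`. [cite: MochizukiEtTh2009, Prop 2.2 (i) p.37] -/
theorem completionAut_mul_self_mem_iff :
    (∀ g ∈ X.DeltaHat, X.completionAut α g * g ∈ (⁅X.DeltaHat, X.DeltaHat⁆).topologicalClosure) ↔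
      ∀ x ∈ X.DeltaTemp, X.toHat (α x * x) ∈ (⁅X.DeltaHat, X.DeltaHat⁆).topologicalClosure := by
  constructor
  · intro h x hx
    have h1 := h (X.toHat x) (Subgroup.le_topologicalClosure _ ⟨x, hx, rfl⟩)
    rwa [completionAut_toHat, ← map_mul] at h1
  · exact X.completionAut_mul_self_mem_of_toHat α _ (Subgroup.isClosed_topologicalClosure _)

/-- **Sufficient tempered form of (R1e′)**: if `α x · x ∈ ⁅Δ^temp_X, Δ^temp_X⁆` for every `x ∈ Δ^temp_X` («`α` acts as `−1` on
`(Δ^temp_X)^ab`»), then `α̂` acts as `−1` on `Δ_X^ab`. [cite: MochizukiEtTh2009, Prop 2.2 (i) p.37] -/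
theorem completionAut_mul_self_mem_of_deltaTemp
    (h : ∀ x ∈ X.DeltaTemp, α x * x ∈ ⁅X.DeltaTemp, X.DeltaTemp⁆) :
    ∀ g ∈ X.DeltaHat, X.completionAut α g * g ∈ (⁅X.DeltaHat, X.DeltaHat⁆).topologicalClosure := by
  refine (X.completionAut_mul_self_mem_iff α).mpr fun x hx => ?_
  have h1 : X.toHat (α x * x) ∈ (⁅X.DeltaTemp, X.DeltaTemp⁆).map X.toHat.toMonoidHom := ⟨_, h x hx, rfl⟩
  rw [Subgroup.map_commutator] at h1
  exact Subgroup.le_topologicalClosure _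
    (Subgroup.commutator_mono (Subgroup.le_topologicalClosure _) (Subgroup.le_topologicalClosure _) h1)

/-- The same with the closure of the tempered commutator subgroup (for non-discrete `Π^temp_X`): if
`α x · x ∈ closure ⁅Δ^temp_X, Δ^temp_X⁆` for every `x ∈ Δ^temp_X`, then `α̂` acts as `−1` on `Δ_X^ab`.
[cite: MochizukiEtTh2009, Prop 2.2 (i) p.37] -/
theorem completionAut_mul_self_mem_of_deltaTemp_closure
    (h : ∀ x ∈ X.DeltaTemp, α x * x ∈ (⁅X.DeltaTemp, X.DeltaTemp⁆).topologicalClosure) :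
    ∀ g ∈ X.DeltaHat, X.completionAut α g * g ∈ (⁅X.DeltaHat, X.DeltaHat⁆).topologicalClosure := by
  refine (X.completionAut_mul_self_mem_iff α).mpr fun x hx => ?_
  -- `ι_X` maps `closure ⁅Δ^temp, Δ^temp⁆` into `closure ι_X ⁅Δ^temp, Δ^temp⁆ ⊆ closure ⁅Δ_X, Δ_X⁆`
  have hle : (⁅X.DeltaTemp, X.DeltaTemp⁆).map X.toHat.toMonoidHom ≤ (⁅X.DeltaHat, X.DeltaHat⁆).topologicalClosure := by
    rw [Subgroup.map_commutator]
    exact (Subgroup.commutator_mono (Subgroup.le_topologicalClosure _) (Subgroup.le_topologicalClosure _)).trans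
      (Subgroup.le_topologicalClosure _)
  have hcl : ((⁅X.DeltaTemp, X.DeltaTemp⁆).topologicalClosure).map X.toHat.toMonoidHom ≤
      (⁅X.DeltaHat, X.DeltaHat⁆).topologicalClosure := by
    rintro _ ⟨y, hy, rfl⟩
    have hy' : y ∈ closure ((⁅X.DeltaTemp, X.DeltaTemp⁆ : Subgroup X.PiTemp) : Set X.PiTemp) := by
      rw [← Subgroup.topologicalClosure_coe]; exact hy
    have himg := image_closure_subset_closure_image X.toHat.continuous ⟨y, hy', rfl⟩
    have hsub : closure (X.toHat '' ((⁅X.DeltaTemp, X.DeltaTemp⁆ : Subgroup X.PiTemp) : Set X.PiTemp)) ⊆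
        ((⁅X.DeltaHat, X.DeltaHat⁆).topologicalClosure : Set X.PiHat) :=
      closure_minimal (by rintro _ ⟨z, hz, rfl⟩; exact hle ⟨z, hz, rfl⟩) (Subgroup.isClosed_topologicalClosure _)
    exact hsub himg
  exact hcl ⟨_, h x hx, rfl⟩

/-- Conversely (R1e′) restricts to the tempered group: `ι_X(α x · x) ∈ closure ⁅Δ_X, Δ_X⁆` for `x ∈ Δ^temp_X`.
[cite: MochizukiEtTh2009, Prop 2.2 (i) p.37] -/
theorem toHat_mul_self_mem_of_completionAut
    (h : ∀ g ∈ X.DeltaHat, X.completionAut α g * g ∈ (⁅X.DeltaHat, X.DeltaHat⁆).topologicalClosure)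
    {x : X.PiTemp} (hx : x ∈ X.DeltaTemp) :
    X.toHat (α x * x) ∈ (⁅X.DeltaHat, X.DeltaHat⁆).topologicalClosure :=
  (X.completionAut_mul_self_mem_iff α).mp h x hx

end TemperedCurve

end Literature.AnabelianGeometry.SemiGraphs

end
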